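import Summits.QuantumFields.YangMills.Theorems.UV3BranchExpansionCountingAmortized
import Summits.QuantumFields.YangMills.Theorems.UV3BranchExpansionCountingRecursion
import HarnessLib

/-!
# `UV3BranchExpansionCountingAmortizedUniform` — THE KNIT: the amortized covering inequality with its LEVEL-UNIFORM constant, one name for
# the hTop assembly (crux `UnitScaleTilt.HistoryTailL`, stmt-QuantumFields-19936 — SUPPLY side, record-independent finite combinatorics)

Cell `ym3-torus` (YM ladder rung R3 = continuum SU(2) Yang–Mills on T³ — a RUNG, NOT d = 4, NOT infinite volume, NOT a mass gap, NOT Clay);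
width seat `ym-ust-19936-w2` (gen 17), explicit-unit helper; `--supports stmt-QuantumFields-19936 --as helper`.  THEOREMS ONLY (0 `def`,
0 `sorry`, default heartbeats).

WHAT.  ✓`UV3BranchExpansionCountingAmortized.sum_pow_card_le_of_discoverable` (this seat, (F-C1′b)) bounds the discoverable-pattern sum of the
branch expansion by `(1 + D_n)^{|β n|}` for ANY `D ≥ 0` dominating the multiplier recursion; ✓`UV3BranchExpansionCountingRecursion.
exists_amortised_envelope` (px13 g13, (F-C2′) v1.2) produces such a `D` together with the LEVEL-FREE bound `D_i ≤ (2/(1−θ₀))·x'`,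
`x' = x/y^{s₀}`, from two closed smallness inequalities.  THIS FILE composes them (GO px13 g13 2026-08-30T04:18Z):

★★★ `sum_pow_card_le_exp_of_smallness`: under the six geometric hypotheses at every level pair `i < n` (the dischargeable shape on a finite tower), the reader capacity `s₀`, the
hypothesis-specified `Dist ∕ X ∕ N` of `UV3BranchExpansionCountingAmortizedInduction`, `0 ≤ x`, `0 < y ≤ 1`, and numbers `θ₀ < 1` with
`(1 + (2/(1−θ₀))x')^{r₀} ≤ 2` and `(y + (2/(1−θ₀))x')^{L−1}·(1 + 2x'/y)^{(L−1)ρ₀} ≤ θ₀`: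
**`Σ_{𝐬 discoverable from Dist 𝐬 n} x^{|𝐬|} ≤ exp(|β n| · (2/(1−θ₀)) · x')`** — NO `D`, NO dependence on the number `n` of levels: the counting
half of hTop's K-uniform constant `c = |PBond(K)|·(2/(1−θ₀))·x'` (★★ `sum_pow_card_le_pow_of_smallness`: the same `≤ (1 + (2/(1−θ₀))x')^{|β n|}`).
The two smallness rows are the `∃ θ₀ < 1`-shaped hypotheses of OWNER WORD 89 (5)(c); numerals live in the memo (e.g. `y = 0.9`, `θ₀ = 0.85` at
`L = 3`, `s₀ = 10`, `ρ₀ = 11`, `r₀ = 162`, `x = 1.2·10⁻⁵`: `x' = 3.44·10⁻⁵`, rows `1.08 ≤ 2` and `0.812 ≤ 0.85`).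

HONEST SCOPE.  [folklore] composition of two landed abstract theorems; the model instantiation (✓`UV3BranchExpansionReadSetBounds` for the seven
geometric letters, (F-M1) for `Dist`), lemma (M) ((F-M2)), the measure-side assembly (F-TOP) are NOT here.  Nothing of hTop, the χ record
`AlphaInputsT3ACv4RecChi`, (O‴χₛ), `HistoryTailL`, R3 is proved; the Yang–Mills mass gap is NOT proved.

References: T. Bałaban, CMP **102** (1985) 255–275 [Balaban1985UV3]; LEAD note `Cruxes/HistoryTailL/HTopBranchExpansion.md` v1.2 §5 (C′)
(2026-08-30); OWNER FINDING #51.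
-/

set_option autoImplicit false

namespace Summit.QuantumFields.YangMills.Theorems.UV3BranchExpansionCountingAmortizedUniform

open Finset Summit.QuantumFields.YangMills.Theorems.UV3BranchExpansionCountingAmortized
  Summit.QuantumFields.YangMills.Theorems.UV3BranchExpansionCountingRecursion

variable {β : ℕ → Type*} [∀ i, DecidableEq (β i)] [∀ i, Fintype (β i)] {n : ℕ}
variable (R line : (i : ℕ) → β (i + 1) → Finset (β i)) (ctr : (i : ℕ) → β (i + 1) → β i)
variable (Dist : ((i : Fin n) → Finset (β ((i : ℕ) + 1))) → (i : ℕ) → Finset (β i))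
variable (X : (m : ℕ) → Finset (β m) → ((i : Fin n) → Finset (β ((i : ℕ) + 1))) → (i : ℕ) → Finset (β i))
variable (N : (i : ℕ) → Finset (β (i + 1)) → Finset (β (i + 1)))
variable {L r₀ ρ₀ s₀ : ℕ}

/-- ★★ **THE AMORTIZED COVERING INEQUALITY, LEVEL-UNIFORM POLYNOMIAL FORM**: under the two closed smallness rows,
`Σ_{𝐬 discoverable from Dist 𝐬 n} x^{|𝐬|} ≤ (1 + (2/(1−θ₀))·x')^{|β n|}`, `x' = x / y^{s₀}`. [folklore] -/
theorem sum_pow_card_le_pow_of_smallness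
    (hctr : ∀ i, i < n → ∀ g, ctr i g ∈ line i g) (hline : ∀ i, i < n → ∀ g, (line i g).card = L)
    (hdisj : ∀ i, i < n → ∀ g g', g ≠ g' → Disjoint (line i g) (line i g'))
    (hpriv : ∀ i, i < n → ∀ g c, ctr i g ∈ R i c → c = g) (hR : ∀ i, i < n → ∀ c, (R i c).card ≤ r₀)
    (hρ : ∀ i, i < n → ∀ b : β i, (Finset.univ.filter (fun c => b ∈ R i c)).card ≤ ρ₀)
    (hcap : ∀ i, i < n → ∀ c : β (i + 1),
      (((Finset.univ.erase c).biUnion (fun g => (line i g).erase (ctr i g))) ∩ R i c).card ≤ s₀)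
    (hDist0 : ∀ p, Dist p 0 = ∅)
    (hDistS : ∀ p (i : Fin n) (g : β ((i : ℕ) + 1)),
      g ∈ Dist p ((i : ℕ) + 1) ↔ g ∈ p i ∨ line i g ⊆ Dist p i ∪ (p i).biUnion (R i))
    (hXm : ∀ m (A : Finset (β m)) p, X m A p m = A)
    (hXS : ∀ m (A : Finset (β m)) p (i : Fin n), (i : ℕ) < m →
      X m A p i = ((X m A p ((i : ℕ) + 1) \ p i).biUnion (line i) ∪ (p i).biUnion (R i)) ∩ Dist p i)
    (hN : ∀ i G c, c ∈ N i G ↔ ∃ g ∈ G, ∃ b ∈ (line i g).erase (ctr i g), b ∈ R i c)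
    {x y θ₀ : ℝ} (hx : 0 ≤ x) (hy : 0 < y) (hy1 : y ≤ 1) (hθ₀ : θ₀ < 1)
    (hsmallE : (1 + 2 / (1 - θ₀) * (x / y ^ s₀)) ^ r₀ ≤ 2)
    (hsmallG : (y + 2 / (1 - θ₀) * (x / y ^ s₀)) ^ (L - 1) * (1 + 2 * (x / y ^ s₀) / y) ^ ((L - 1) * ρ₀) ≤ θ₀) :
    ∑ p ∈ (Finset.univ : Finset ((i : Fin n) → Finset (β ((i : ℕ) + 1)))).filter
        (fun p => ∀ i : Fin n, p i ⊆ X n (Dist p n) p ((i : ℕ) + 1) ∪ N i (X n (Dist p n) p ((i : ℕ) + 1) \ p i)),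
      x ^ (∑ i : Fin n, (p i).card) ≤ (1 + 2 / (1 - θ₀) * (x / y ^ s₀)) ^ Fintype.card (β n) := by
  obtain ⟨D, hD0, -, hstep, hDle⟩ :=
    exists_amortised_envelope (r₀ := r₀) (L := L) (ρ₀ := ρ₀) (s₀ := s₀) hx hy hθ₀ hsmallE hsmallG
  have hcover := sum_pow_card_le_of_discoverable_of_lt R line ctr Dist X N hctr hline hdisj hpriv hR hρ hcap hDist0 hDistS hXm hXS hN
    hx hy hy1 hD0 (fun i _ => hstep i)
  exact hcover.trans (pow_le_pow_left₀ (by linarith [hD0 n]) (by linarith [hDle n]) _)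

/-- ★★★ **THE AMORTIZED COVERING INEQUALITY WITH ITS LEVEL-UNIFORM CONSTANT (exponential form — the shape of hTop's constant).**
`Σ_{𝐬 discoverable from Dist 𝐬 n} x^{|𝐬|} ≤ exp(|β n| · (2/(1−θ₀)) · x / y^{s₀})` under the two closed smallness rows; the right-hand side does not
depend on the number `n` of averaging levels. [folklore] -/
theorem sum_pow_card_le_exp_of_smallness
    (hctr : ∀ i, i < n → ∀ g, ctr i g ∈ line i g) (hline : ∀ i, i < n → ∀ g, (line i g).card = L)
    (hdisj : ∀ i, i < n → ∀ g g', g ≠ g' → Disjoint (line i g) (line i g'))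
    (hpriv : ∀ i, i < n → ∀ g c, ctr i g ∈ R i c → c = g) (hR : ∀ i, i < n → ∀ c, (R i c).card ≤ r₀)
    (hρ : ∀ i, i < n → ∀ b : β i, (Finset.univ.filter (fun c => b ∈ R i c)).card ≤ ρ₀)
    (hcap : ∀ i, i < n → ∀ c : β (i + 1),
      (((Finset.univ.erase c).biUnion (fun g => (line i g).erase (ctr i g))) ∩ R i c).card ≤ s₀)
    (hDist0 : ∀ p, Dist p 0 = ∅)
    (hDistS : ∀ p (i : Fin n) (g : β ((i : ℕ) + 1)),
      g ∈ Dist p ((i : ℕ) + 1) ↔ g ∈ p i ∨ line i g ⊆ Dist p i ∪ (p i).biUnion (R i))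
    (hXm : ∀ m (A : Finset (β m)) p, X m A p m = A)
    (hXS : ∀ m (A : Finset (β m)) p (i : Fin n), (i : ℕ) < m →
      X m A p i = ((X m A p ((i : ℕ) + 1) \ p i).biUnion (line i) ∪ (p i).biUnion (R i)) ∩ Dist p i)
    (hN : ∀ i G c, c ∈ N i G ↔ ∃ g ∈ G, ∃ b ∈ (line i g).erase (ctr i g), b ∈ R i c)
    {x y θ₀ : ℝ} (hx : 0 ≤ x) (hy : 0 < y) (hy1 : y ≤ 1) (hθ₀ : θ₀ < 1)
    (hsmallE : (1 + 2 / (1 - θ₀) * (x / y ^ s₀)) ^ r₀ ≤ 2)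
    (hsmallG : (y + 2 / (1 - θ₀) * (x / y ^ s₀)) ^ (L - 1) * (1 + 2 * (x / y ^ s₀) / y) ^ ((L - 1) * ρ₀) ≤ θ₀) :
    ∑ p ∈ (Finset.univ : Finset ((i : Fin n) → Finset (β ((i : ℕ) + 1)))).filter
        (fun p => ∀ i : Fin n, p i ⊆ X n (Dist p n) p ((i : ℕ) + 1) ∪ N i (X n (Dist p n) p ((i : ℕ) + 1) \ p i)),
      x ^ (∑ i : Fin n, (p i).card) ≤ Real.exp (Fintype.card (β n) * (2 / (1 - θ₀) * (x / y ^ s₀))) := by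
  obtain ⟨D, hD0, -, hstep, hDle⟩ :=
    exists_amortised_envelope (r₀ := r₀) (L := L) (ρ₀ := ρ₀) (s₀ := s₀) hx hy hθ₀ hsmallE hsmallG
  have hcover := sum_pow_card_le_of_discoverable_of_lt R line ctr Dist X N hctr hline hdisj hpriv hR hρ hcap hDist0 hDistS hXm hXS hN
    hx hy hy1 hD0 (fun i _ => hstep i)
  refine hcover.trans ((one_add_pow_le_exp_mul (hD0 n) _).trans (Real.exp_le_exp.mpr ?_))
  exact mul_le_mul_of_nonneg_left (hDle n) (Nat.cast_nonneg _)

end Summit.QuantumFields.YangMills.Theorems.UV3BranchExpansionCountingAmortizedUniform
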